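/-
Copyright (c) 2026 the pub-hodgecm-mathlib formalisation cell (harness21).  Prover seat hodgecm-mathlib-K2Liu-p09 (g0): Track B «K2-LIT»,
#184♮ = hLiu418 = stmt-HodgeConjecture-24832, file #9 of the K2_Liu road (socket module
`Cruxes/HLiu418/Lines/K2_Liu_CurveThetaSigs_U3a_SiegelEisenstein.lean`), organ (III-b) step E3b; 2026-09-03.
-/
import Literature.NumberTheory.K2Lit.SiegelEisensteinSeriesDoubled            -- ★ `siegelDelta`, `siegelDeltaRat`, `SiegelDeltaQuot`
import Literature.NumberTheory.Automorphic.UnitaryGroupOfFormAdelicTopology    -- ★ second countability of `U(J)(𝔸)`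
import Literature.NumberTheory.Automorphic.UnitaryGroupRationalDiscrete         -- ★ `discreteTopology_range_toAdelic`
import Literature.MeasureTheory.Group.CoveringWeights                          -- ★ `IsCoveringWeight`, `lintegral_mul_eq_lintegral_tsum_mul`
import Mathlib.MeasureTheory.Group.Measure
import HarnessLib

/-!
# Crux `HLiu418`, Track B road `K2_Liu`, unit U3a «SIEGEL EISENSTEIN SERIES», file #9 — helper 7 (organ (III-b), step E3b «UNFOLD»):
# `∫_{H(L⁺)\H(𝔸)} Σ_{γ ∈ P_Δ(L⁺)\H(L⁺)} F(γ x) = ∫_{P_Δ(L⁺)\H(𝔸)} F` in the covering-weight currency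

Cell `hodgecm-mathlib`, crux item hLiu418 = `stmt-HodgeConjecture-24832`, route of record `HCCMUnconditional`; squad K2 ∕ K2Liu,
prover K2Liu-p09 (g0).  THEOREMS ONLY (no `def`, no instance, no notation, no named-fact hypothesis, no `sorry`); lane
`--supports stmt-HodgeConjecture-24832` (count-neutral helper toward socket #9 `sig_K2LiuSiegelEisensteinDoubledSummable`).

Step E3b of Godement's count ([Garrett2018, §3.10]: «`∫_C Σ_{γ ∈ P_k\G_k} φ(γ g) dg = ∫_{Z_𝔸 P_k\G_k·C} φ`»), written with the tree's COVERING
WEIGHTS (★ `Literature.MeasureTheory.Group.CoveringWeights`: no quotient spaces; a `Γ`-weight `β` has `Σ_{γ∈Γ} β(γ x) = 1`): for the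
doubled group `H(𝔸)` (★ `GRConstruction.HA`) with a left-invariant measure `μ`, the rational points `Γ = H(L⁺)` (★ `ratH`, countable)
and the rational Siegel parabolic `Γ' = P_Δ(L⁺) = P_Δ(𝔸) ⊓ H(L⁺)` (★ `siegelDelta`), with coset representatives `γ_q = (Quotient.out q : H(L⁺))`,
`q ∈ P_Δ(L⁺)\H(L⁺)` (★ `SiegelDeltaQuot`):

* `countable_ratH`; `existsUnique_siegelDeltaQuot` — every `γ ∈ H(L⁺)` has a unique `q` with `γ γ_q⁻¹ ∈ P_Δ(L⁺)`;
* **`lintegral_tsum_translate_mul_weight_eq`** — for measurable `F ≥ 0` left-`P_Δ(L⁺)`-invariant, an `H(L⁺)`-weight `β` and a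
  `P_Δ(L⁺)`-weight `β'`:  `∫⁻ (Σ'_q F(γ_q x)) · β x dμ = ∫⁻ F x · β' x dμ`  (★ `lintegral_mul_eq_lintegral_tsum_mul`);
* `exists_isCoveringWeight_ratH`, `exists_isCoveringWeight_siegelDeltaRat` — such weights exist (★ `exists_isCoveringWeight`:
  discrete subgroups of the second countable `H(𝔸)`).

HONEST LABEL.  Count-neutral helper of the K2_Liu road; it retires nothing by itself: `HC_CM` is proved only modulo the 7 printed
citations (2 remaining named inputs: hLiu418 = `stmt-HodgeConjecture-24832`, h413 = `stmt-HodgeConjecture-24833`) until rung 0 closes.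

## References
* [Garrett2018] P. Garrett, *Modern Analysis of Automorphic Forms by Example* (2018), §3.10 (proof of Cor. 3.10.2), §1.8.
* [CogdellAnalyticTheory2004] J. W. Cogdell, *Analytic theory of L-functions for GL_n* (2004), §2.3 (unfolding).
* [Liu2021] Y. Liu, Camb. J. Math. 9 (2021), App. B §B.3 p. 101, Lem. B.10 (2).
-/

set_option autoImplicit false
-- the mandated namespace repeats the single-problem summit's segment (`HodgeConjecture.HodgeConjecture`)
set_option linter.dupNamespace false

noncomputable section

open scoped Matrix Pointwise ENNReal NNReal
open NumberField IsDedekindDomain MeasureTheory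

namespace Summit.HodgeConjecture.HodgeConjecture.Cruxes.HLiu418.K2LiuSiegelDoubledUnfold

open Literature.NumberTheory.Automorphic Literature.NumberTheory.Automorphic.UnitaryGroup
open Literature.NumberTheory.GelbartRogawski1991 Literature.NumberTheory.GelbartRogawski1991.GRConstruction
open Literature.NumberTheory.K2Lit.SiegelDoubled
open Literature.MeasureTheory.Group

variable (L : Type) [Field L] [NumberField L] [IsCMField L]
variable {N M n : ℕ} (e : Fin N × Fin M ≃ Fin n)
  (dV : Fin N → L) (hdV : ∀ i, IsCMField.complexConj L (dV i) = dV i)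
  (dW : Fin M → L) (hdW : ∀ i, IsCMField.complexConj L (dW i) = dW i)

/-! ## §1 Countability and the coset representatives -/

/-- `H(L⁺)` is countable (it is the image of the countable `U(J^𝔻)(L⁺) ≤ GL_{n+n}(L)`). [cite: Garrett2018, §1.8] -/
theorem countable_ratH : Countable (ratH L e dV hdV dW hdW) := by
  haveI : Countable L := NumberField.countable' (K := L)
  haveI : Countable (Matrix (Fin (n + n)) (Fin (n + n)) L) := inferInstanceAs (Countable (Fin (n + n) → Fin (n + n) → L))
  haveI : Countable (GL (Fin (n + n)) L) := Units.val_injective.countable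
  haveI : Countable (rational (Fp L) L (IsCMField.complexConj L) (n + n) (hermD L e dV hdV dW hdW)) :=
    Subtype.countable
  exact (Set.countable_range (UnitaryGroup.toAdelic (Fp L) L (IsCMField.complexConj L) (n + n) (hermD L e dV hdV dW hdW))).to_subtype

/-- The rational Siegel parabolic as a subgroup of `H(𝔸)`: `P_Δ(𝔸) ⊓ H(L⁺) ≤ H(L⁺)`. [cite: Liu2021, §B.3 p. 101] -/
theorem siegelDelta_inf_ratH_le : siegelDelta L e dV hdV dW hdW ⊓ ratH L e dV hdV dW hdW ≤ ratH L e dV hdV dW hdW :=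
  inf_le_right

/-- **Coset representatives**: every `γ ∈ H(L⁺)` has a UNIQUE `q ∈ P_Δ(L⁺)\H(L⁺)` with `γ · γ_q⁻¹ ∈ P_Δ(L⁺)`, `γ_q = Quotient.out q`.
[cite: Garrett2018, §3.10] -/
theorem existsUnique_siegelDeltaQuot (γ : HA L e dV hdV dW hdW) (hγ : γ ∈ ratH L e dV hdV dW hdW) :
    ∃! q : SiegelDeltaQuot L e dV hdV dW hdW,
      γ * (((Quotient.out q : ratH L e dV hdV dW hdW) : HA L e dV hdV dW hdW))⁻¹ ∈
        siegelDelta L e dV hdV dW hdW ⊓ ratH L e dV hdV dW hdW := by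
  set γ' : ratH L e dV hdV dW hdW := ⟨γ, hγ⟩ with hγ'
  -- the class of `γ'`
  let q₀ : SiegelDeltaQuot L e dV hdV dW hdW :=
    Quotient.mk (MulAction.orbitRel (siegelDeltaRat L e dV hdV dW hdW) (ratH L e dV hdV dW hdW)) γ'
  have key : ∀ q : SiegelDeltaQuot L e dV hdV dW hdW,
      γ * (((Quotient.out q : ratH L e dV hdV dW hdW) : HA L e dV hdV dW hdW))⁻¹ ∈
        siegelDelta L e dV hdV dW hdW ⊓ ratH L e dV hdV dW hdW ↔ q = q₀ := by
    intro q
    constructor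
    · intro h
      -- `γ (out q)⁻¹ = p ∈ P_Δ(L⁺)`, so `out q = p⁻¹ • γ'` lies in the orbit of `γ'`
      have hrel : MulAction.orbitRel (siegelDeltaRat L e dV hdV dW hdW) (ratH L e dV hdV dW hdW) (Quotient.out q) γ' := by
        refine MulAction.orbitRel_apply.2 (MulAction.mem_orbit_iff.2 ⟨⟨⟨γ * (((Quotient.out q : ratH L e dV hdV dW hdW) :
          HA L e dV hdV dW hdW))⁻¹, (Subgroup.mem_inf.1 h).2⟩, Subgroup.mem_subgroupOf.2 (Subgroup.mem_inf.1 h).1⟩⁻¹, ?_⟩)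
        apply Subtype.ext
        show ((γ * (((Quotient.out q : ratH L e dV hdV dW hdW) : HA L e dV hdV dW hdW))⁻¹)⁻¹ * γ : HA L e dV hdV dW hdW) = _
        rw [mul_inv_rev, inv_inv, mul_assoc, inv_mul_cancel, mul_one]
      rw [← Quotient.out_eq q]
      exact Quotient.sound hrel
    · rintro rfl
      -- `out q₀ = p • γ'` with `p ∈ P_Δ(L⁺)`
      have hrel : MulAction.orbitRel (siegelDeltaRat L e dV hdV dW hdW) (ratH L e dV hdV dW hdW) (Quotient.out q₀) γ' :=
        Quotient.exact (Quotient.out_eq q₀)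
      obtain ⟨p, hp⟩ := MulAction.mem_orbit_iff.1 (MulAction.orbitRel_apply.1 hrel)
      have hval : (((Quotient.out q₀ : ratH L e dV hdV dW hdW) : HA L e dV hdV dW hdW)) =
          ((p : ratH L e dV hdV dW hdW) : HA L e dV hdV dW hdW) * γ := by
        rw [← hp]; rfl
      rw [hval, mul_inv_rev, ← mul_assoc, mul_inv_cancel, one_mul]
      exact Subgroup.mem_inf.2 ⟨(Subgroup.inv_mem_iff _).2 (Subgroup.mem_subgroupOf.1 p.2),
        Subgroup.inv_mem _ (p : ratH L e dV hdV dW hdW).2⟩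
  exact ⟨q₀, (key q₀).2 rfl, fun q hq => (key q).1 hq⟩

/-! ## §2 The unfolding identity -/

variable [MeasurableSpace (HA L e dV hdV dW hdW)] [BorelSpace (HA L e dV hdV dW hdW)]

/-- **UNFOLD** (`P_Δ(L⁺)\H(L⁺)`-sum against `H(L⁺)\H(𝔸)` = integral over `P_Δ(L⁺)\H(𝔸)`), in the covering-weight currency: for a
left-invariant measure `μ` on `H(𝔸)`, measurable `F ≥ 0` with `F(p x) = F(x)` for `p ∈ P_Δ(L⁺)`, an `H(L⁺)`-covering weight `β` and a
`P_Δ(L⁺)`-covering weight `β'`:  `∫⁻ (Σ'_{q} F(γ_q x)) β(x) dμ = ∫⁻ F(x) β'(x) dμ`, `γ_q = Quotient.out q`.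
[cite: Garrett2018, §3.10 (proof of Cor. 3.10.2)] [cite: CogdellAnalyticTheory2004, §2.3] -/
theorem lintegral_tsum_translate_mul_weight_eq (μ : Measure (HA L e dV hdV dW hdW)) [μ.IsMulLeftInvariant]
    {F : HA L e dV hdV dW hdW → ℝ≥0∞} (hF : Measurable F)
    (hFinv : ∀ p ∈ siegelDelta L e dV hdV dW hdW ⊓ ratH L e dV hdV dW hdW, ∀ x : HA L e dV hdV dW hdW, F (p * x) = F x)
    {β β' : HA L e dV hdV dW hdW → ℝ≥0∞} (hβ : IsCoveringWeight (ratH L e dV hdV dW hdW) β)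
    (hβ' : IsCoveringWeight (↥(siegelDelta L e dV hdV dW hdW ⊓ ratH L e dV hdV dW hdW)) β') :
    ∫⁻ x, (∑' q : SiegelDeltaQuot L e dV hdV dW hdW,
        F ((((Quotient.out q : ratH L e dV hdV dW hdW) : HA L e dV hdV dW hdW)) * x)) * β x ∂μ =
      ∫⁻ x, F x * β' x ∂μ := by
  haveI : Countable (ratH L e dV hdV dW hdW) := countable_ratH L e dV hdV dW hdW
  haveI : Countable (SiegelDeltaQuot L e dV hdV dW hdW) := by
    unfold SiegelDeltaQuot; exact inferInstance
  haveI : MeasurableConstSMul (HA L e dV hdV dW hdW) (HA L e dV hdV dW hdW) := ⟨fun g => measurable_const_mul g⟩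
  haveI : SMulInvariantMeasure (HA L e dV hdV dW hdW) (HA L e dV hdV dW hdW) μ :=
    ⟨fun g s _hs => by rw [show (fun x : HA L e dV hdV dW hdW => g • x) ⁻¹' s = (fun x => g * x) ⁻¹' s from rfl,
      measure_preimage_mul]⟩
  symm
  exact lintegral_mul_eq_lintegral_tsum_mul μ (ratH L e dV hdV dW hdW) (siegelDelta L e dV hdV dW hdW ⊓ ratH L e dV hdV dW hdW)
    (siegelDelta_inf_ratH_le L e dV hdV dW hdW) hF hFinv hβ'.1 hβ'.2 hβ.1 hβ.2
    (s := fun q : SiegelDeltaQuot L e dV hdV dW hdW => (((Quotient.out q : ratH L e dV hdV dW hdW) : HA L e dV hdV dW hdW)))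
    (fun q => (Quotient.out q : ratH L e dV hdV dW hdW).2)
    (fun γ hγ => existsUnique_siegelDeltaQuot L e dV hdV dW hdW γ hγ)

/-- An `H(L⁺)`-covering weight on `H(𝔸)` exists (★ `exists_isCoveringWeight`: `H(L⁺)` is discrete in the second countable `H(𝔸)`).
[cite: Garrett2018, §1.8] -/
theorem exists_isCoveringWeight_ratH : ∃ β : HA L e dV hdV dW hdW → ℝ≥0∞, IsCoveringWeight (ratH L e dV hdV dW hdW) β := by
  haveI : DiscreteTopology (ratH L e dV hdV dW hdW) :=
    discreteTopology_range_toAdelic (Fp L) L (IsCMField.complexConj L) (n + n) (hermD L e dV hdV dW hdW)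
  exact exists_isCoveringWeight (ratH L e dV hdV dW hdW)

/-- A `P_Δ(L⁺)`-covering weight on `H(𝔸)` exists. [cite: Garrett2018, §1.8] -/
theorem exists_isCoveringWeight_siegelDeltaRat :
    ∃ β' : HA L e dV hdV dW hdW → ℝ≥0∞, IsCoveringWeight (↥(siegelDelta L e dV hdV dW hdW ⊓ ratH L e dV hdV dW hdW)) β' := by
  haveI : DiscreteTopology (ratH L e dV hdV dW hdW) :=
    discreteTopology_range_toAdelic (Fp L) L (IsCMField.complexConj L) (n + n) (hermD L e dV hdV dW hdW)
  haveI : DiscreteTopology (siegelDelta L e dV hdV dW hdW ⊓ ratH L e dV hdV dW hdW : Subgroup (HA L e dV hdV dW hdW)) :=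
    DiscreteTopology.of_subset ‹DiscreteTopology (ratH L e dV hdV dW hdW)› (siegelDelta_inf_ratH_le L e dV hdV dW hdW)
  exact exists_isCoveringWeight (siegelDelta L e dV hdV dW hdW ⊓ ratH L e dV hdV dW hdW)

end Summit.HodgeConjecture.HodgeConjecture.Cruxes.HLiu418.K2LiuSiegelDoubledUnfold

end
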